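import Summits.QuantumFields.YangMills.Theorems.IR.BlockedActivityWDecay
import Mathlib.Analysis.Normed.Ring.InfiniteSum
import HarnessLib

/-!
# Crux `IR` (stmt-QuantumFields-19354), lane B «strong coupling AFTER BLOCKING»: chain representations, part 1 — signed labels and the bond law

Helper module for item `stmt-QuantumFields-19354` (`--supports`; it closes nothing), lane `ym-19354-onsetsc-p2` (g4); part 1 of the chain
construction for the located open question Q-loc (realisability of the LOCAL class `BlockedRepOnLoc`, p547052): the σ-INDEPENDENT reference of a
chain representation — i.i.d. SIGNED LABELS `(i, ±)` on the bonds with masses `t_i ∕ (2Z)` (`Weights`: `t_i ≥ 0`, `Σ t_i = Z ∈ (0, 1∕2]`;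
`labelPMF`, `labelLaw`, `chainLaw = Measure.pi`) — and its two computational rules: **double centring** (`integral_eq_zero_of_odd`: a bounded
function odd under the sign flip of one bond integrates to zero — the flip is a mass-preserving involution of the countable label space) and **the
chain sum** (`integral_allEq`: a function supported on «all mode indices agree» integrates to `Σ_i (t_i∕Z)^{m+1} K_i`).  The factors, the vanishing
of proper sub-products and the representation are parts 2–4 (`BlockedActivityWLocChainFactors ∕ …ChainData ∕ …Chain`).

HONEST FRAMING: probability bookkeeping on a countable product space; nothing about Yang–Mills, weak coupling, a gap or Clay.
No `sorry`; axioms ⊆ {propext, Classical.choice, Quot.sound}; no instances, no notation.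
Refs: KoteckyPreiss1986; FriedliVelenik2017 §5.7.1; BauerschmidtBrydgesSlade2019 §3.3 (finite range ⇒ factorisation).
-/


set_option autoImplicit false

noncomputable section

open MeasureTheory ProbabilityTheory Finset
open scoped ENNReal
open Literature.MathematicalPhysics.QuantumFieldTheory Literature.MathematicalPhysics.QuantumLattice
open Literature.Probability.LatticeModels (IsLocalPerturbation IsLocalObservable pertExpect pertNum pertZ Touches)
open Summit.QuantumFields.YangMills.Cruxes.IR.Tempered (cellEdges windowCells regionEdges)

namespace Summit.QuantumFields.YangMills.Cruxes.IR.BlockedActivity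

namespace Chain

/-! ## §1 Signed labels, sign flips -/

/-- A bond label: a mode index and a sign. -/
abbrev Label : Type := ℕ × Bool

/-- The label configurations of the `m+1` bonds of a chain of `m+2` cells. -/
abbrev BondCfg (m : ℕ) : Type := Fin (m + 1) → Label

/-- The sign of a label as the real number `±1`. -/
def sgn (l : Label) : ℝ := if l.2 then 1 else -1

/-- `sgn² = 1`. -/
theorem sgn_mul_self (l : Label) : sgn l * sgn l = 1 := by
  unfold sgn; split_ifs <;> norm_num

/-- `|sgn| = 1`. -/
theorem abs_sgn (l : Label) : |sgn l| = 1 := by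
  unfold sgn; split_ifs <;> norm_num

/-- Flipping the sign negates `sgn`. -/
theorem sgn_not (l : Label) : sgn (l.1, !l.2) = -sgn l := by
  unfold sgn; cases l.2 <;> simp

/-- Flip the sign of the label of bond `j`. -/
def flipAt {m : ℕ} (j : Fin (m + 1)) (b : BondCfg m) : BondCfg m :=
  fun k => if k = j then ((b k).1, !(b k).2) else b k

/-- The flip does not change mode indices. -/
theorem flipAt_fst {m : ℕ} (j : Fin (m + 1)) (b : BondCfg m) (k : Fin (m + 1)) : (flipAt j b k).1 = (b k).1 := by
  unfold flipAt; split_ifs <;> rfl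

/-- The flip is an involution. -/
theorem flipAt_flipAt {m : ℕ} (j : Fin (m + 1)) (b : BondCfg m) : flipAt j (flipAt j b) = b := by
  funext k
  unfold flipAt
  split_ifs with h
  · simp
  · rfl

/-- The sign after a flip. -/
theorem sgn_flipAt {m : ℕ} (j : Fin (m + 1)) (b : BondCfg m) (k : Fin (m + 1)) :
    sgn (flipAt j b k) = (if k = j then -1 else 1) * sgn (b k) := by
  unfold flipAt
  split_ifs with h
  · rw [sgn_not]; ring
  · ring

/-- The flip as a permutation of the label configurations. -/
def flipEquiv {m : ℕ} (j : Fin (m + 1)) : BondCfg m ≃ BondCfg m :=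
  Function.Involutive.toPerm (flipAt j) (flipAt_flipAt j)

/-- The realised centre observable on the label space: `A + ½ sgn₀ D_{i₀}` (`A = ∫ f dγ_τ`, `D_i` the centred mode integrals of `f`). -/
def obsR {m : ℕ} (A : ℝ) (D : ℕ → ℝ) (b : BondCfg m) : ℝ := A + 1 / 2 * sgn (b 0) * D (b 0).1

/-! ## §2 The weights and the bond law -/

/-- The weights of a chain representation: `t_i ≥ 0` summing to `Z ∈ (0, 1∕2]` (mode weights `s_i = t_i^{m+2}`, `Z` = the root functional). -/
structure Weights where
  /-- the per-bond transmission weights -/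
  t : ℕ → ℝ
  /-- their sum, the activity radius -/
  Z : ℝ
  /-- non-negativity -/
  t_nonneg : ∀ i, 0 ≤ t i
  /-- `Σ t_i = Z` -/
  hasSum_t : HasSum t Z
  /-- `0 < Z` -/
  Z_pos : 0 < Z
  /-- `Z ≤ 1∕2` -/
  Z_le : Z ≤ 1 / 2

namespace Weights

variable (W : Weights)

/-- Each weight is at most the total. -/
theorem t_le_Z (i : ℕ) : W.t i ≤ W.Z :=
  le_hasSum W.hasSum_t i fun j _ => W.t_nonneg j

/-- `Z ≤ 1`. -/
theorem Z_le_one : W.Z ≤ 1 := W.Z_le.trans (by norm_num)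

/-- The mass of a label: `t_i ∕ (2Z)`, blind to the sign. -/
def labelMass (l : Label) : ℝ≥0∞ := ENNReal.ofReal (W.t l.1 / (2 * W.Z))

/-- The label masses are non-negative reals. -/
theorem labelMass_arg_nonneg (i : ℕ) : 0 ≤ W.t i / (2 * W.Z) :=
  div_nonneg (W.t_nonneg i) (by linarith [W.Z_pos])

/-- The label masses sum to `1`. -/
theorem hasSum_labelMass : HasSum W.labelMass 1 := by
  refine ENNReal.summable.hasSum_iff.2 ?_
  rw [ENNReal.tsum_prod']
  have h2 : ∀ i : ℕ, (∑' s : Bool, W.labelMass (i, s)) = ENNReal.ofReal (W.t i / W.Z) := fun i => by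
    rw [tsum_fintype, Fintype.sum_bool]
    unfold labelMass
    rw [← ENNReal.ofReal_add (W.labelMass_arg_nonneg i) (W.labelMass_arg_nonneg i)]
    congr 1
    field_simp
    ring
  simp_rw [h2]
  rw [← ENNReal.ofReal_tsum_of_nonneg (fun i => div_nonneg (W.t_nonneg i) W.Z_pos.le) (W.hasSum_t.summable.div_const W.Z),
    tsum_div_const, W.hasSum_t.tsum_eq, div_self W.Z_pos.ne', ENNReal.ofReal_one]

/-- The law of one bond label. -/
def labelPMF : PMF Label := ⟨W.labelMass, W.hasSum_labelMass⟩

/-- The law of one bond label as a measure. -/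
def labelLaw : Measure Label := W.labelPMF.toMeasure

/-- It is a probability measure. -/
theorem isProbabilityMeasure_labelLaw : IsProbabilityMeasure W.labelLaw := by
  unfold labelLaw; infer_instance

/-- Mass of a single label. -/
theorem labelLaw_real_singleton (l : Label) : W.labelLaw.real {l} = W.t l.1 / (2 * W.Z) := by
  rw [measureReal_def]
  unfold labelLaw
  rw [PMF.toMeasure_apply_singleton _ _ (MeasurableSet.singleton l)]
  show (W.labelMass l).toReal = _
  unfold labelMass
  rw [ENNReal.toReal_ofReal (W.labelMass_arg_nonneg l.1)]

/-- The reference law of the chain: independent labels on the `m+1` bonds. -/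
def chainLaw (m : ℕ) : Measure (BondCfg m) := Measure.pi fun _ : Fin (m + 1) => W.labelLaw

/-- It is a probability measure. -/
theorem isProbabilityMeasure_chainLaw (m : ℕ) : IsProbabilityMeasure (W.chainLaw m) := by
  haveI := W.isProbabilityMeasure_labelLaw
  unfold chainLaw; infer_instance

/-- Mass of a single label configuration. -/
theorem chainLaw_real_singleton {m : ℕ} (b : BondCfg m) :
    (W.chainLaw m).real {b} = ∏ k, W.t (b k).1 / (2 * W.Z) := by
  haveI := W.isProbabilityMeasure_labelLaw
  rw [measureReal_def]
  unfold chainLaw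
  rw [Measure.pi_singleton, ENNReal.toReal_prod]
  refine prod_congr rfl fun k _ => ?_
  rw [← measureReal_def, labelLaw_real_singleton]

/-- The single-configuration masses are non-negative. -/
theorem chainLaw_real_singleton_nonneg {m : ℕ} (b : BondCfg m) : 0 ≤ (W.chainLaw m).real {b} := measureReal_nonneg

/-- A sign flip preserves the mass. -/
theorem chainLaw_real_flipAt {m : ℕ} (j : Fin (m + 1)) (b : BondCfg m) :
    (W.chainLaw m).real {flipAt j b} = (W.chainLaw m).real {b} := by
  rw [chainLaw_real_singleton, chainLaw_real_singleton]
  exact prod_congr rfl fun k _ => by rw [flipAt_fst]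

/-- Integrals against the chain law are sums over label configurations. -/
theorem integral_eq_tsum {m : ℕ} (H : BondCfg m → ℝ) (C : ℝ) (hC : ∀ b, |H b| ≤ C) :
    ∫ b, H b ∂(W.chainLaw m) = ∑' b, (W.chainLaw m).real {b} * H b := by
  haveI := W.isProbabilityMeasure_chainLaw m
  have hint : Integrable H (W.chainLaw m) :=
    Integrable.of_bound (measurable_of_countable H).aestronglyMeasurable C
      (Filter.Eventually.of_forall fun b => by rw [Real.norm_eq_abs]; exact hC b)
  rw [integral_countable hint]
  simp_rw [smul_eq_mul]

/-- **Double centring.** A bounded function that is ODD under the sign flip of one bond integrates to zero. -/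
theorem integral_eq_zero_of_odd {m : ℕ} (j : Fin (m + 1)) (H : BondCfg m → ℝ) (C : ℝ) (hC : ∀ b, |H b| ≤ C)
    (hodd : ∀ b, H (flipAt j b) = -H b) : ∫ b, H b ∂(W.chainLaw m) = 0 := by
  rw [W.integral_eq_tsum H C hC]
  set F : BondCfg m → ℝ := fun b => (W.chainLaw m).real {b} * H b with hF
  have h1 : ∑' b, F (flipEquiv j b) = ∑' b, F b := Equiv.tsum_eq (flipEquiv j) F
  have h2 : ∀ b, F (flipEquiv j b) = -F b := fun b => by
    show (W.chainLaw m).real {flipAt j b} * H (flipAt j b) = -((W.chainLaw m).real {b} * H b)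
    rw [chainLaw_real_flipAt, hodd]; ring
  simp_rw [h2, tsum_neg] at h1
  linarith

/-- The embedding of «one mode index, arbitrary signs» into the label configurations. -/
def constIdx (m : ℕ) (p : ℕ × (Fin (m + 1) → Bool)) : BondCfg m := fun k => (p.1, p.2 k)

/-- It is injective. -/
theorem constIdx_injective (m : ℕ) : Function.Injective (constIdx m) := by
  intro p q h
  have h0 : (constIdx m p) 0 = (constIdx m q) 0 := by rw [h]
  refine Prod.ext (by simpa [constIdx] using congrArg Prod.fst h0) (funext fun k => ?_)
  have hk : (constIdx m p) k = (constIdx m q) k := by rw [h]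
  simpa [constIdx] using congrArg Prod.snd hk

/-- **The chain sum.** A function supported on «all mode indices agree» integrates to the mode sum weighted by `(t_i ∕ Z)^{m+1}`:
all `m+1` independent labels must show the mode, the signs are free. -/
theorem integral_allEq {m : ℕ} (K : ℕ → ℝ) (C : ℝ) (hC0 : 0 ≤ C) (hK : ∀ i, |K i| ≤ C) :
    ∫ b, (if ∀ k, (b k).1 = (b 0).1 then K (b 0).1 else 0) ∂(W.chainLaw m) = ∑' i, (W.t i / W.Z) ^ (m + 1) * K i := by
  set H : BondCfg m → ℝ := fun b => if ∀ k, (b k).1 = (b 0).1 then K (b 0).1 else 0 with hH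
  have hHb : ∀ b, |H b| ≤ C := fun b => by
    simp only [hH]; split_ifs
    · exact hK _
    · rw [abs_zero]; exact hC0
  rw [W.integral_eq_tsum H C hHb]
  set F : BondCfg m → ℝ := fun b => (W.chainLaw m).real {b} * H b with hF
  -- the summand is supported on the range of `constIdx`
  have hsupp : Function.support F ⊆ Set.range (constIdx m) := by
    intro b hb
    have hH0 : H b ≠ 0 := fun h => hb (by simp only [hF, h, mul_zero])
    have hall : ∀ k, (b k).1 = (b 0).1 := by
      by_contra h; exact hH0 (by simp only [hH, if_neg h])
    exact ⟨((b 0).1, fun k => (b k).2), funext fun k => Prod.ext (by simp [constIdx, hall k]) (by simp [constIdx])⟩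
  rw [← (constIdx_injective m).tsum_eq hsupp]
  -- on the range the summand is a product function
  set u : ℕ → ℝ := fun i => (W.t i / (2 * W.Z)) ^ (m + 1) * K i with hu
  have hFι : ∀ p : ℕ × (Fin (m + 1) → Bool), F (constIdx m p) = u p.1 * (fun _ => (1 : ℝ)) p.2 := fun p => by
    have hall : ∀ k, (constIdx m p k).1 = (constIdx m p 0).1 := fun k => rfl
    have hHp : H (constIdx m p) = K p.1 := by
      show (if (∀ k, (constIdx m p k).1 = (constIdx m p 0).1) then K (constIdx m p 0).1 else 0) = K p.1
      rw [if_pos hall]; rfl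
    have hw : (W.chainLaw m).real {constIdx m p} = (W.t p.1 / (2 * W.Z)) ^ (m + 1) := by
      rw [chainLaw_real_singleton]
      show ∏ _k : Fin (m + 1), W.t p.1 / (2 * W.Z) = _
      rw [prod_const, card_univ, Fintype.card_fin]
    show (W.chainLaw m).real {constIdx m p} * H (constIdx m p) = _
    rw [hw, hHp, hu]; simp
  simp_rw [hFι]
  have hun : Summable fun i => ‖u i‖ := by
    refine Summable.of_nonneg_of_le (fun i => norm_nonneg _) (fun i => ?_) ((W.hasSum_t.summable.div_const (2 * W.Z)).mul_right C)
    rw [hu, norm_mul, norm_pow, Real.norm_eq_abs, Real.norm_eq_abs, abs_of_nonneg (W.labelMass_arg_nonneg i)]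
    have hx1 : W.t i / (2 * W.Z) ≤ 1 := by
      rw [div_le_one (by linarith [W.Z_pos])]; linarith [W.t_le_Z i, W.Z_pos]
    exact mul_le_mul (pow_le_of_le_one (W.labelMass_arg_nonneg i) hx1 (Nat.succ_ne_zero m)) (hK i) (abs_nonneg _)
      (W.labelMass_arg_nonneg i)
  have hvn : Summable fun _ : Fin (m + 1) → Bool => ‖(1 : ℝ)‖ := (hasSum_fintype _).summable
  have hone : (∑' _ : Fin (m + 1) → Bool, (1 : ℝ)) = 2 ^ (m + 1) := by
    rw [tsum_fintype, sum_const, card_univ, Fintype.card_pi_const, Fintype.card_bool]; simp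
  rw [← tsum_mul_tsum_of_summable_norm hun hvn, hone, ← tsum_mul_right]
  refine tsum_congr fun i => ?_
  have hZ : W.Z ≠ 0 := W.Z_pos.ne'
  have h2 : (W.t i / (2 * W.Z)) ^ (m + 1) * (2 : ℝ) ^ (m + 1) = (W.t i / W.Z) ^ (m + 1) := by
    rw [← mul_pow]; congr 1; field_simp
  simp only [hu]
  rw [mul_right_comm, h2]

end Weights

end Chain

end Summit.QuantumFields.YangMills.Cruxes.IR.BlockedActivity

end
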